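import Summits.QuantumFields.YangMills.Theorems.AlphaInputsT3ACv3NewtonLiftFramedLinearisation
import Summits.QuantumFields.YangMills.Theorems.AlphaInputsT3ACv3StartDefectCore
import Literature.MathematicalPhysics.QuantumFieldTheory.Balaban1983to89.B12RTGaugeInvariance254
import HarnessLib

/-!
# Route `UnitScaleTilt`, crux K1 child «MinimiserStabilityRegPr» (stmt-QuantumFields-19200), route-R GROWTH (MAP #3 M10, S3 «nonlinear passage»), brick (b) —
# **THE FIBRE IDENTITY MAKES THE LINEARISED (0.4)-CONSTRAINT DEFECT QUADRATIC, LOCALLY**: if `avg^k W(c) = avg^k U₀(c)` and, in SOME finest gauge `σ`, `U₀^σ` is `η`-flat and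
# `W^σ − U₀^σ` is `ρ`-small ON THE TWO `k`-BLOCKS OF `c` ONLY, then `‖Q^{(k)}(W^σ − U₀^σ)(c)‖ ≤ C₂·m(ρ)·(m(ρ) + m(η))`, `m(x) = (d+1)L^k·x` — the sup enters only LOCALLY

Cell `ym3-torus`, keyed width hand `ym-routeR-w3` (D-0154 (3c); MAP #3 row M10 (b); LOCATED 2026-08-28 05:10Z (L2) on the cell bus).  THEOREMS ONLY (0 `def`, 0 `sorry`);
`--supports stmt-QuantumFields-19200`, count-neutral.  YM₃ on T³ is a ladder rung (R3), not the Clay problem; nothing here claims the stub, the crux, d = 4 or the mass gap.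

WHY (numbers, from the LOCATE).  In the passage to (ii′) both fields of the pair lie in the same (0.4)-fibre, `avg^k W = avg^k U₀` (pinned representative, `g↓ = 1`).  The LINEARISED
constraint `Q^{(k)}Y = 0` is therefore violated only at second order.  The tree's every-`L` two-field row (`EMLIterUniformAllL.norm_iter_sub_iter_sub_iterLin_le_uniform_allL`,
✓, ★w5-19936) gives `‖(Ū₁ − Ū₂)^{(k)}(c) − Q^{(k)}(U₁ − U₂)(c)‖ ≤ C₂·m_k(ρ)(m_k(ρ) + m_k(δ))` for `U₂` GLOBALLY `δ`-flat — a window a curved background on T³ never has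
(★w4-19200 g2 LOCATED 04:43Z).  But the k-fold average AND its linearisation are TWO-BLOCK LOCAL (★alpha-2 `iter_blockAvg_congr₂_of_blocks_subset`, ★w4-19936
`linAvgIterM_congr₂_of_blocks_subset`) and GAUGE COVARIANT (`T4Continuum.iter_gaugeAct`): so the row may be run on the CUT-OFF pair (`W^σ`, `U₀^σ` on the bonds inside a stencil
`N ⊇ B^k(c₋) ∪ B^k(c₊)`, `1` elsewhere) — flatness is asked of `U₀^σ` on `N` only (★w4-19200's (T1): `η = 3ε₀L^{−(K−n)}` in the centre-axial gauge, inside the window since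
`L^{K−n}η = 3ε₀`), the sup `ρ` of `W − U₀` is taken on `N` only, and the fibre identity at `c` kills the zeroth-order term exactly.  The LOCAL sup is what makes the `ℓ²`
bookkeeping k-uniform under the card's interior-regularity input (LOCATE (L2): `Σ_c‖q_c‖² ≤ C₂²(d+1)⁴ℓ⁴Σ_cρ_c⁴ ≤ C₂²(d+1)⁴ℓ⁴·s²·Σ_cρ_c²` and `ρ_c² ≤ C_reg·ℓ^{−3}·Σ_{B̃(c)}‖Y‖²`
gives a cost `O(ε₂²)·ℓ^{−2}·Σ‖Y‖²` in S2′'s bookkeeping; with the GLOBAL sup it would be off by `ℓ³`).  The junction between the FRAMED flat linearisation `Q^{(k)}(W^σ − U₀^σ)`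
used here and the true covariant linearisation of the curved N6 ((R-A) `covIterLin`) is the (T2)-hand's and is NOT made here.

WHAT IS PROVED (ns `…Theorems.Prop7FibreQDefect`; `Q^{(k)} = LinearLiftMatrix.linAvgIterM k`, `m(x) = (d+1)L^k x`, `ℓ′ = (d+2)L`, `C₂ = (d+1)·18^d(2+(d+1)18^d)·5200ℓ′²∕(L(L−1))`).
* ★★ `norm_linAvgIterM_gauged_sub_le_of_iter_eq` — ANY `SU(n)`, any `k ≤ m + K`, any finest gauge `σ`, any stencil `N ⊇ B^k(c₋) ∪ B^k(c₊)`: from `avg^k W(c) = avg^k U₀(c)`,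
  `‖(U₀^σ)_b − 1‖ ≤ η` and `‖W_b − U₀,b‖ ≤ ρ` on the bonds inside `N`, and the three smallness rows of the two-field theorem at `(ρ, η)`:
  `‖Q^{(k)}(b ↦ (W^σ)_b − (U₀^σ)_b)(c)‖ ≤ C₂·m(ρ)·(m(ρ) + m(η))`.
* ★ `norm_linAvgIterM_sub_one_le_of_iter_eq_one` — the flat datum (`σ = 1`, `U₀ = 1`, `η = 0`): `avg^k W(c) = 1`, `‖W_b − 1‖ ≤ ρ` on `N` ⟹ `‖Q^{(k)}(W − 1)(c)‖ ≤ C₂·m(ρ)²`.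
* §3 `sum_ite_src_or_tgt_le`, `sum_sum_twoBlock_le` (the two-block stencils overlap at most `2d` times), `sum_sq_le_of_localSup_of_localReg` (the `ℓ²` bookkeeping: `q_c ≤ Aρ_c(Bρ_c + D)`,
  `ρ_c ≤ s`, `ρ_c² ≤ C_reg·V⁻¹·M_c` ⟹ `Σ_cq_c² ≤ A²(Bs+D)²·C_regV⁻¹·2d·Σ_bf(b)`).
* §4 ★★ `sum_normSq_linAvgIterM_sub_one_le_of_localReg` — the flat datum in `ℓ²`: `Σ_c‖Q^{(k)}(W − 1)(c)‖² ≤ (C₂(d+1)L^k)²·((d+1)L^k s)²·C_reg(L^k)^{−3}·2d·Σ_b‖W_b − 1‖²`, i.e.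
  `[2d(d+1)⁴C₂²C_reg]·(L^k s)²·L^k·Σ‖Y‖²` — `O(ε₂²)` in both S2′'s and N8's bookkeeping at `s = ε₂L^{−k}`, k-UNIFORM under the displayed mean-value input.

HONEST SCOPE.  A re-run of the tree's two-field row on cut-off fields (★w4-19936's transfer pattern `NewtonLiftFramed` §2–§3, there for the log-defect) plus finite bookkeeping; the gauges
`σ_c`, the flatness `η`, the local radii `ρ_c` and the interior mean-value input `C_reg` are INPUTS (the card §2(d) `s_loc` regularity of the optimal representative — OPEN); the curved
`ℓ²` sum (gauges `σ_c` varying with `c`) and the junction with the curved N6's linearisation are NOT here.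

References: T. Bałaban, Commun. Math. Phys. 98 (1985) 17–51 [Balaban1985Averaging] ((11)–(13) p.19, Prop. 4 (134)–(135) p.38, Prop. 5 (156)–(157) p.42); CMP 102 (1985) 277–309
[Balaban1985Variational] ((4)–(8) pp.278–279, (15) p.280); CMP 109 (1987) 249–301 [Balaban1987RG1] ((0.4), (0.11) p.253).
-/

set_option autoImplicit false

noncomputable section

open scoped Matrix.Norms.L2Operator

namespace Summit.QuantumFields.YangMills.Theorems.Prop7FibreQDefect

open Literature.MathematicalPhysics.QuantumFieldTheory.Balaban1983to89
open Literature.MathematicalPhysics.QuantumFieldTheory.Balaban1983to89.B5Eq118OneStroke (iterBlockOf)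
open T4Continuum BlockAveraging ExpMeanLog BlockAveragingEMLLinearised
open Summit.QuantumFields.YangMills.Theorems.LinearLiftMatrix (linAvgIterM linAvgIterM_zero linAvgIterM_succ)
open Summit.QuantumFields.YangMills.Theorems.EMLIterUniformAllL (norm_iter_sub_iter_sub_iterLin_le_uniform_allL)
open Summit.QuantumFields.YangMills.Theorems.NewtonLiftFramed (linAvgIterM_congr₂_of_blocks_subset)
open Summit.QuantumFields.YangMills.Theorems.AvgIterLocality (iter_blockAvg_congr₂_of_blocks_subset)
open Summit.QuantumFields.YangMills.Theorems.CovLinAvgFrame (coe_gaugeAct)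
open Summit.QuantumFields.YangMills.Theorems.StartDefectCore (iter_blockAvg_expMeanLogSU_one)

variable {P : Params} {n : Type*} [Fintype n] [DecidableEq n] [Nonempty n]

/-! ## §1 ★★ The quadratic constraint defect in a stencil gauge -/

/-- ★★ **THE FIBRE IDENTITY MAKES THE LINEARISED CONSTRAINT DEFECT QUADRATIC — LOCAL-GAUGE, LOCAL-SUP FORM.**  `k ≤ m + K`; `σ` ANY finest gauge transformation; `N` ANY set of fine
sites containing the two `k`-blocks of the level-`k` bond `c`; `W`, `U₀` finest `SU(n)` fields with THE SAME `k`-fold (0.4)-average AT `c`; on the bonds with both ends in `N`: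
`‖(U₀^σ)_b − 1‖ ≤ η` and `‖W_b − U₀,b‖ ≤ ρ`; the smallness rows of the every-`L` two-field theorem at `(ρ, η)` (`m(x) = (d+1)L^k x`, `ℓ′ = (d+2)L`): `C₁·m(η) ≤ 1`,
`200ℓ′(m(ρ)+m(η)) ≤ 1`, `C₂(m(ρ)+m(η)) ≤ 1`, `4ℓ′(m(ρ)+m(η)) < δ_N`.  THEN `‖Q^{(k)}(b ↦ (W^σ)_b − (U₀^σ)_b)(c)‖ ≤ C₂·m(ρ)·(m(ρ) + m(η))` — the framed linearised constraint
defect at `c` is second order in the LOCAL sup `ρ` (plus `ρ·η`).  Proof: the two-field row on the cut-off pair (`W^σ`, `U₀^σ` inside `N`, `1` outside), two-block locality of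
`avg^k` and of `Q^{(k)}`, gauge covariance of `avg^k`. [cite: Balaban1985Averaging, (11)–(13) p.19, Prop. 4 (134)–(135) p.38, Prop. 5 (156)–(157) p.42; Balaban1987RG1, (0.4)+(0.11) p.253] -/
theorem norm_linAvgIterM_gauged_sub_le_of_iter_eq {k : ℕ} (hk : k ≤ P.m + P.K) (σ : GaugeTransf P 0 (Matrix.specialUnitaryGroup n ℂ))
    (N : Set (Site P 0)) (c : PBond P k) (hN : ∀ x : Site P 0, (iterBlockOf k x = c.src ∨ iterBlockOf k x = c.tgt) → x ∈ N)
    (W U₀ : GaugeField P 0 (Matrix.specialUnitaryGroup n ℂ))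
    (hfib : Averaging.iter (fun i => blockAvg (P := P) (j := i) (expMeanLogSU (n := n))) k W c =
      Averaging.iter (fun i => blockAvg (P := P) (j := i) (expMeanLogSU (n := n))) k U₀ c)
    {ρ η : ℝ} (hρ0 : 0 ≤ ρ) (hη0 : 0 ≤ η)
    (hU₀ : ∀ b : PBond P 0, b.src ∈ N → b.tgt ∈ N → ‖((GaugeField.gaugeAct σ U₀ b : Matrix.specialUnitaryGroup n ℂ) : Matrix n n ℂ) - 1‖ ≤ η)
    (hρ : ∀ b : PBond P 0, b.src ∈ N → b.tgt ∈ N → ‖((W b : Matrix.specialUnitaryGroup n ℂ) : Matrix n n ℂ) - ((U₀ b : Matrix.specialUnitaryGroup n ℂ) : Matrix n n ℂ)‖ ≤ ρ)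
    (hmδ : (((P.d : ℝ) + 1) * ((18 : ℝ) ^ P.d * (2 + ((P.d : ℝ) + 1) * (18 : ℝ) ^ P.d)) * (324 * (((P.d + 2) * P.L : ℕ) : ℝ) ^ 2) /
        ((P.L : ℝ) * ((P.L : ℝ) - 1))) * (((P.d : ℝ) + 1) * (P.L : ℝ) ^ k * η) ≤ 1)
    (h200 : 200 * (((P.d + 2) * P.L : ℕ) : ℝ) * (((P.d : ℝ) + 1) * (P.L : ℝ) ^ k * ρ + ((P.d : ℝ) + 1) * (P.L : ℝ) ^ k * η) ≤ 1)
    (hm : (((P.d : ℝ) + 1) * ((18 : ℝ) ^ P.d * (2 + ((P.d : ℝ) + 1) * (18 : ℝ) ^ P.d)) * (5200 * (((P.d + 2) * P.L : ℕ) : ℝ) ^ 2) /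
        ((P.L : ℝ) * ((P.L : ℝ) - 1))) * (((P.d : ℝ) + 1) * (P.L : ℝ) ^ k * ρ + ((P.d : ℝ) + 1) * (P.L : ℝ) ^ k * η) ≤ 1)
    (hNδ : 4 * (((P.d + 2) * P.L : ℕ) : ℝ) * (((P.d : ℝ) + 1) * (P.L : ℝ) ^ k * ρ + ((P.d : ℝ) + 1) * (P.L : ℝ) ^ k * η) < deltaSU n) :
    ‖linAvgIterM k (fun b => ((GaugeField.gaugeAct σ W b : Matrix.specialUnitaryGroup n ℂ) : Matrix n n ℂ)
        - ((GaugeField.gaugeAct σ U₀ b : Matrix.specialUnitaryGroup n ℂ) : Matrix n n ℂ)) c‖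
      ≤ (((P.d : ℝ) + 1) * ((18 : ℝ) ^ P.d * (2 + ((P.d : ℝ) + 1) * (18 : ℝ) ^ P.d)) * (5200 * (((P.d + 2) * P.L : ℕ) : ℝ) ^ 2) /
          ((P.L : ℝ) * ((P.L : ℝ) - 1))) *
        ((((P.d : ℝ) + 1) * (P.L : ℝ) ^ k * ρ) * ((((P.d : ℝ) + 1) * (P.L : ℝ) ^ k * ρ) + (((P.d : ℝ) + 1) * (P.L : ℝ) ^ k * η))) := by
  classical
  set av : (i : ℕ) → Averaging P i (Matrix.specialUnitaryGroup n ℂ) := fun i => blockAvg (P := P) (j := i) (expMeanLogSU (n := n)) with hav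
  have hQ0 : ∀ Y : PBond P 0 → Matrix n n ℂ, linAvgIterM 0 Y = Y := fun Y => linAvgIterM_zero Y
  have hQs : ∀ (i : ℕ) (Y : PBond P 0 → Matrix n n ℂ) (c : PBond P (i + 1)), linAvgIterM (i + 1) Y c = linAvg (linAvgIterM i Y) c :=
    fun i Y c => linAvgIterM_succ i Y c
  -- the cut-off pair
  let InN : PBond P 0 → Prop := fun b => b.src ∈ N ∧ b.tgt ∈ N
  let W₁ : GaugeField P 0 (Matrix.specialUnitaryGroup n ℂ) := fun b => if InN b then GaugeField.gaugeAct σ W b else 1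
  let W₂ : GaugeField P 0 (Matrix.specialUnitaryGroup n ℂ) := fun b => if InN b then GaugeField.gaugeAct σ U₀ b else 1
  have hW₁_in : ∀ b : PBond P 0, b.src ∈ N → b.tgt ∈ N → W₁ b = GaugeField.gaugeAct σ W b := fun b h1 h2 => if_pos ⟨h1, h2⟩
  have hW₂_in : ∀ b : PBond P 0, b.src ∈ N → b.tgt ∈ N → W₂ b = GaugeField.gaugeAct σ U₀ b := fun b h1 h2 => if_pos ⟨h1, h2⟩
  -- global sizes of the cut-offs
  have hW₂_one : ∀ b, ‖((W₂ b : Matrix.specialUnitaryGroup n ℂ) : Matrix n n ℂ) - 1‖ ≤ η := by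
    intro b
    by_cases hb : InN b
    · have e : W₂ b = GaugeField.gaugeAct σ U₀ b := if_pos hb
      rw [e]; exact hU₀ b hb.1 hb.2
    · have e : W₂ b = 1 := if_neg hb
      rw [e]; simpa using hη0
  have hW₁_W₂ : ∀ b, ‖((W₁ b : Matrix.specialUnitaryGroup n ℂ) : Matrix n n ℂ) - ((W₂ b : Matrix.specialUnitaryGroup n ℂ) : Matrix n n ℂ)‖ ≤ ρ := by
    intro b
    by_cases hb : InN b
    · have e : W₁ b = GaugeField.gaugeAct σ W b := if_pos hb
      have e' : W₂ b = GaugeField.gaugeAct σ U₀ b := if_pos hb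
      rw [e, e', coe_gaugeAct, coe_gaugeAct, ← sub_mul, ← mul_sub, CStarRing.norm_mul_mem_unitary _ (Unitary.star_mem (σ b.tgt).2.1),
        CStarRing.norm_mem_unitary_mul _ (σ b.src).2.1]
      exact hρ b hb.1 hb.2
    · have e : W₁ b = 1 := if_neg hb
      have e' : W₂ b = 1 := if_neg hb
      rw [e, e', sub_self, norm_zero]; exact hρ0
  -- the two-field row on the cut-offs, at `c`
  have h2f := norm_iter_sub_iter_sub_iterLin_le_uniform_allL linAvgIterM hQ0 hQs W₁ W₂ hη0 hρ0 hW₂_one hW₁_W₂ k hk hmδ h200 hm hNδ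
  obtain ⟨-, hrow⟩ := h2f k le_rfl c
  -- the zeroth-order term vanishes: locality + covariance + the fibre identity at `c`
  have h1 : Averaging.iter av k W₁ c = Averaging.iter av k (GaugeField.gaugeAct σ W) c :=
    iter_blockAvg_congr₂_of_blocks_subset (expMeanLogSU (n := n)) hk N hW₁_in c hN
  have h2 : Averaging.iter av k W₂ c = Averaging.iter av k (GaugeField.gaugeAct σ U₀) c :=
    iter_blockAvg_congr₂_of_blocks_subset (expMeanLogSU (n := n)) hk N hW₂_in c hN
  have h12 : Averaging.iter av k W₁ c = Averaging.iter av k W₂ c := by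
    rw [h1, h2, T4Continuum.iter_gaugeAct av σ k hk W, T4Continuum.iter_gaugeAct av σ k hk U₀]
    show transfUp σ k c.src * Averaging.iter av k W c * (transfUp σ k c.tgt)⁻¹ = transfUp σ k c.src * Averaging.iter av k U₀ c * (transfUp σ k c.tgt)⁻¹
    rw [hfib]
  -- the linearised term sees only the stencil
  have hQ : linAvgIterM k (fun b => ((W₁ b : Matrix.specialUnitaryGroup n ℂ) : Matrix n n ℂ) - ((W₂ b : Matrix.specialUnitaryGroup n ℂ) : Matrix n n ℂ)) c
      = linAvgIterM k (fun b => ((GaugeField.gaugeAct σ W b : Matrix.specialUnitaryGroup n ℂ) : Matrix n n ℂ)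
        - ((GaugeField.gaugeAct σ U₀ b : Matrix.specialUnitaryGroup n ℂ) : Matrix n n ℂ)) c :=
    linAvgIterM_congr₂_of_blocks_subset hk N _ _ (fun b h1 h2 => by simp only [hW₁_in b h1 h2, hW₂_in b h1 h2]) c hN
  rw [h12, sub_self, zero_sub, norm_neg, hQ] at hrow
  exact hrow

/-! ## §2 ★ The flat datum: `avg^k W(c) = 1` -/

/-- ★ **FLAT DATUM**: `k ≤ m + K`, `N ⊇ B^k(c₋) ∪ B^k(c₊)`, `W` a finest `SU(n)` field with `avg^k W(c) = 1` and `‖W_b − 1‖ ≤ ρ` on the bonds inside `N`, smallness rows at `(ρ, 0)`: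
`‖Q^{(k)}(W − 1)(c)‖ ≤ C₂·m(ρ)²` — the constraint defect of a fibre point over the trivial datum is quadratic in the LOCAL sup.
[cite: Balaban1985Averaging, Prop. 4 (134)–(135) p.38, Prop. 5 (156)–(157) p.42; Balaban1987RG1, (0.4)+(0.11) p.253] -/
theorem norm_linAvgIterM_sub_one_le_of_iter_eq_one {k : ℕ} (hk : k ≤ P.m + P.K)
    (N : Set (Site P 0)) (c : PBond P k) (hN : ∀ x : Site P 0, (iterBlockOf k x = c.src ∨ iterBlockOf k x = c.tgt) → x ∈ N)
    (W : GaugeField P 0 (Matrix.specialUnitaryGroup n ℂ))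
    (hfib : Averaging.iter (fun i => blockAvg (P := P) (j := i) (expMeanLogSU (n := n))) k W c = 1)
    {ρ : ℝ} (hρ0 : 0 ≤ ρ)
    (hρ : ∀ b : PBond P 0, b.src ∈ N → b.tgt ∈ N → ‖((W b : Matrix.specialUnitaryGroup n ℂ) : Matrix n n ℂ) - 1‖ ≤ ρ)
    (h200 : 200 * (((P.d + 2) * P.L : ℕ) : ℝ) * (((P.d : ℝ) + 1) * (P.L : ℝ) ^ k * ρ) ≤ 1)
    (hm : (((P.d : ℝ) + 1) * ((18 : ℝ) ^ P.d * (2 + ((P.d : ℝ) + 1) * (18 : ℝ) ^ P.d)) * (5200 * (((P.d + 2) * P.L : ℕ) : ℝ) ^ 2) /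
        ((P.L : ℝ) * ((P.L : ℝ) - 1))) * (((P.d : ℝ) + 1) * (P.L : ℝ) ^ k * ρ) ≤ 1)
    (hNδ : 4 * (((P.d + 2) * P.L : ℕ) : ℝ) * (((P.d : ℝ) + 1) * (P.L : ℝ) ^ k * ρ) < deltaSU n) :
    ‖linAvgIterM k (fun b => ((W b : Matrix.specialUnitaryGroup n ℂ) : Matrix n n ℂ) - 1) c‖
      ≤ (((P.d : ℝ) + 1) * ((18 : ℝ) ^ P.d * (2 + ((P.d : ℝ) + 1) * (18 : ℝ) ^ P.d)) * (5200 * (((P.d + 2) * P.L : ℕ) : ℝ) ^ 2) /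
          ((P.L : ℝ) * ((P.L : ℝ) - 1))) * (((P.d : ℝ) + 1) * (P.L : ℝ) ^ k * ρ) ^ 2 := by
  have hone : Averaging.iter (fun i => blockAvg (P := P) (j := i) (expMeanLogSU (n := n))) k (1 : GaugeField P 0 (Matrix.specialUnitaryGroup n ℂ)) c = 1 := by
    rw [iter_blockAvg_expMeanLogSU_one]; rfl
  have hfib' : Averaging.iter (fun i => blockAvg (P := P) (j := i) (expMeanLogSU (n := n))) k W c =
      Averaging.iter (fun i => blockAvg (P := P) (j := i) (expMeanLogSU (n := n))) k (1 : GaugeField P 0 (Matrix.specialUnitaryGroup n ℂ)) c := by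
    rw [hfib, hone]
  have hσ1W : GaugeField.gaugeAct (fun _ : Site P 0 => (1 : Matrix.specialUnitaryGroup n ℂ)) W = W := B12RTGaugeInvariance254.gaugeAct_one' W
  have hσ1U : GaugeField.gaugeAct (fun _ : Site P 0 => (1 : Matrix.specialUnitaryGroup n ℂ)) (1 : GaugeField P 0 (Matrix.specialUnitaryGroup n ℂ)) = 1 :=
    B12RTGaugeInvariance254.gaugeAct_one' _
  have hU₀ : ∀ b : PBond P 0, b.src ∈ N → b.tgt ∈ N →
      ‖((GaugeField.gaugeAct (fun _ : Site P 0 => (1 : Matrix.specialUnitaryGroup n ℂ)) (1 : GaugeField P 0 (Matrix.specialUnitaryGroup n ℂ)) b :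
        Matrix.specialUnitaryGroup n ℂ) : Matrix n n ℂ) - 1‖ ≤ 0 := by
    intro b _ _
    rw [hσ1U]
    show ‖(((1 : Matrix.specialUnitaryGroup n ℂ)) : Matrix n n ℂ) - 1‖ ≤ 0
    simp
  have hρ' : ∀ b : PBond P 0, b.src ∈ N → b.tgt ∈ N →
      ‖((W b : Matrix.specialUnitaryGroup n ℂ) : Matrix n n ℂ) - (((1 : GaugeField P 0 (Matrix.specialUnitaryGroup n ℂ)) b : Matrix.specialUnitaryGroup n ℂ) : Matrix n n ℂ)‖ ≤ ρ := by
    intro b h1 h2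
    show ‖((W b : Matrix.specialUnitaryGroup n ℂ) : Matrix n n ℂ) - (((1 : Matrix.specialUnitaryGroup n ℂ)) : Matrix n n ℂ)‖ ≤ ρ
    simpa using hρ b h1 h2
  have h := norm_linAvgIterM_gauged_sub_le_of_iter_eq hk (fun _ => 1) N c hN W 1 hfib' hρ0 le_rfl hU₀ hρ'
    (by rw [mul_zero, mul_zero]; exact zero_le_one) (by rw [mul_zero, add_zero]; exact h200) (by rw [mul_zero, add_zero]; exact hm)
    (by rw [mul_zero, add_zero]; exact hNδ)
  rw [hσ1W, hσ1U, mul_zero, add_zero] at h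
  have e : (fun b => ((W b : Matrix.specialUnitaryGroup n ℂ) : Matrix n n ℂ) - (((1 : GaugeField P 0 (Matrix.specialUnitaryGroup n ℂ)) b : Matrix.specialUnitaryGroup n ℂ) : Matrix n n ℂ))
      = fun b => ((W b : Matrix.specialUnitaryGroup n ℂ) : Matrix n n ℂ) - 1 := by
    funext b
    show ((W b : Matrix.specialUnitaryGroup n ℂ) : Matrix n n ℂ) - (((1 : Matrix.specialUnitaryGroup n ℂ)) : Matrix n n ℂ) = _
    simp
  rw [e] at h
  have e2 : (((P.d : ℝ) + 1) * (P.L : ℝ) ^ k * ρ) ^ 2 = (((P.d : ℝ) + 1) * (P.L : ℝ) ^ k * ρ) * (((P.d : ℝ) + 1) * (P.L : ℝ) ^ k * ρ) := sq _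
  rw [e2]
  exact h


/-! ## §3 The `ℓ²` bookkeeping over the coarse bonds under a displayed interior-regularity input -/

section Ell2

variable {P : Params}

/-- Counting: a level-`k` site is the source of `d` positive bonds and the target of `d`:
`Σ_c (if y = c₋ ∨ y = c₊ then g else 0) ≤ 2d·g` for `g ≥ 0`. [folklore] -/
theorem sum_ite_src_or_tgt_le {k : ℕ} (y : Site P k) {g : ℝ} (hg : 0 ≤ g) :
    ∑ c : PBond P k, (if (y = c.src ∨ y = c.tgt) then g else 0) ≤ 2 * P.d * g := by
  classical
  have hle : ∀ c : PBond P k, (if (y = c.src ∨ y = c.tgt) then g else 0) ≤ (if c.src = y then g else 0) + (if c.tgt = y then g else 0) := by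
    intro c
    by_cases h1 : c.src = y
    · by_cases h2 : c.tgt = y
      · simp [h1, h2, hg]
      · simp [h1, h2]
    · by_cases h2 : c.tgt = y
      · simp [h1, h2]
      · have : ¬ (y = c.src ∨ y = c.tgt) := by
          rintro (h | h)
          · exact h1 h.symm
          · exact h2 h.symm
        simp [h1, h2, this]
  refine (Finset.sum_le_sum fun c _ => hle c).trans ?_
  rw [Finset.sum_add_distrib, B10StarCount.sum_pbond (fun c : PBond P k => if c.src = y then g else 0),
    B10StarCount.sum_pbond (fun c : PBond P k => if c.tgt = y then g else 0)]
  have h1 : ∑ x : Site P k, ∑ μ : Fin P.d, (if (⟨x, μ⟩ : PBond P k).src = y then g else 0) = P.d * g := by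
    have e : ∀ (x : Site P k) (μ : Fin P.d), (if (⟨x, μ⟩ : PBond P k).src = y then g else 0) = (if x = y then g else 0) := fun x μ => by
      by_cases hx : x = y
      · rw [if_pos hx]
      · rw [if_neg hx]
    simp only [e]
    rw [Finset.sum_comm]
    simp only [Finset.sum_ite_eq', Finset.mem_univ, if_true, Finset.sum_const, Finset.card_univ, Fintype.card_fin, nsmul_eq_mul]
  have h2 : ∑ x : Site P k, ∑ μ : Fin P.d, (if (⟨x, μ⟩ : PBond P k).tgt = y then g else 0) = P.d * g := by
    have e : ∀ (x : Site P k) (μ : Fin P.d), (if (⟨x, μ⟩ : PBond P k).tgt = y then g else 0) = (if x = y.unshift μ then g else 0) := fun x μ => by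
      have hiff : (⟨x, μ⟩ : PBond P k).tgt = y ↔ x = y.unshift μ := by
        show x.shift μ = y ↔ _
        constructor
        · intro h; rw [← h, B10StarCount.unshift_shift]
        · intro h; rw [h, B10StarCount.shift_unshift]
      by_cases hx : x = y.unshift μ
      · rw [if_pos (hiff.mpr hx), if_pos hx]
      · rw [if_neg (fun h => hx (hiff.mp h)), if_neg hx]
    simp only [e]
    rw [Finset.sum_comm]
    simp only [Finset.sum_ite_eq', Finset.mem_univ, if_true, Finset.sum_const, Finset.card_univ, Fintype.card_fin, nsmul_eq_mul]
  rw [h1, h2]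
  ring_nf
  rfl

/-- **OVERLAP OF THE TWO-BLOCK STENCILS**: summing a nonnegative fine-bond function over the bonds whose two ends lie in the two `k`-blocks of `c`, and then over all level-`k` bonds `c`,
counts every fine bond at most `2d` times. [folklore] -/
theorem sum_sum_twoBlock_le {k : ℕ} (f : PBond P 0 → ℝ) (hf : ∀ b, 0 ≤ f b) :
    ∑ c : PBond P k, ∑ b : PBond P 0,
        (if ((iterBlockOf k b.src = c.src ∨ iterBlockOf k b.src = c.tgt) ∧ (iterBlockOf k b.tgt = c.src ∨ iterBlockOf k b.tgt = c.tgt)) then f b else 0)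
      ≤ 2 * P.d * ∑ b : PBond P 0, f b := by
  classical
  rw [Finset.sum_comm, Finset.mul_sum]
  refine Finset.sum_le_sum fun b _ => ?_
  refine le_trans (Finset.sum_le_sum fun c _ => ?_) (sum_ite_src_or_tgt_le (iterBlockOf k b.src) (hf b))
  by_cases h : (iterBlockOf k b.src = c.src ∨ iterBlockOf k b.src = c.tgt) ∧ (iterBlockOf k b.tgt = c.src ∨ iterBlockOf k b.tgt = c.tgt)
  · rw [if_pos h, if_pos h.1]
  · rw [if_neg h]; split_ifs <;> linarith [hf b]

/-- **THE `ℓ²` SUM OF A LOCALLY-SUP-QUADRATIC DEFECT UNDER AN INTERIOR-REGULARITY INPUT** (pure bookkeeping, the shape of the LOCATE (L2)): per coarse bond `c` let `q_c ≤ A·ρ_c·(B·ρ_c + D)`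
with local sups `0 ≤ ρ_c ≤ s` and the displayed mean-value input `ρ_c² ≤ C_reg·V⁻¹·M_c` (`M_c` the two-block mass of a nonnegative fine-bond density `f`, `V > 0` the block volume);
THEN `Σ_c q_c² ≤ A²(Bs + D)²·C_reg·V⁻¹·2d·Σ_b f(b)`. [folklore] -/
theorem sum_sq_le_of_localSup_of_localReg {k : ℕ} (q ρ : PBond P k → ℝ) (f : PBond P 0 → ℝ) (hf : ∀ b, 0 ≤ f b)
    {A B D s Creg V : ℝ} (hA : 0 ≤ A) (hB : 0 ≤ B) (hD : 0 ≤ D) (hCreg : 0 ≤ Creg) (hV : 0 < V)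
    (hq : ∀ c, q c ≤ A * ρ c * (B * ρ c + D)) (hq0 : ∀ c, 0 ≤ q c) (hρ0 : ∀ c, 0 ≤ ρ c) (hρs : ∀ c, ρ c ≤ s)
    (hreg : ∀ c : PBond P k, ρ c ^ 2 ≤ Creg * V⁻¹ * ∑ b : PBond P 0,
        (if ((iterBlockOf k b.src = c.src ∨ iterBlockOf k b.src = c.tgt) ∧ (iterBlockOf k b.tgt = c.src ∨ iterBlockOf k b.tgt = c.tgt)) then f b else 0)) :
    ∑ c : PBond P k, q c ^ 2 ≤ A ^ 2 * (B * s + D) ^ 2 * (Creg * V⁻¹) * (2 * P.d * ∑ b : PBond P 0, f b) := by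
  classical
  have hs0 : ∀ c : PBond P k, 0 ≤ s := fun c => (hρ0 c).trans (hρs c)
  -- per coarse bond: `q_c² ≤ A²(Bs+D)²·ρ_c²`
  have hper : ∀ c : PBond P k, q c ^ 2 ≤ A ^ 2 * (B * s + D) ^ 2 * ρ c ^ 2 := by
    intro c
    have h1 : q c ≤ A * (B * s + D) * ρ c := by
      have : B * ρ c + D ≤ B * s + D := by nlinarith [hρs c]
      calc q c ≤ A * ρ c * (B * ρ c + D) := hq c
        _ ≤ A * ρ c * (B * s + D) := mul_le_mul_of_nonneg_left this (mul_nonneg hA (hρ0 c))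
        _ = A * (B * s + D) * ρ c := by ring
    have h0 : 0 ≤ A * (B * s + D) * ρ c := by
      have := hs0 c
      have : 0 ≤ B * s + D := by nlinarith
      exact mul_nonneg (mul_nonneg hA this) (hρ0 c)
    calc q c ^ 2 ≤ (A * (B * s + D) * ρ c) ^ 2 := pow_le_pow_left₀ (hq0 c) h1 2
      _ = A ^ 2 * (B * s + D) ^ 2 * ρ c ^ 2 := by ring
  have hK0 : 0 ≤ A ^ 2 * (B * s + D) ^ 2 := by positivity
  have hd0 : (0 : ℝ) ≤ P.d := Nat.cast_nonneg _
  calc ∑ c : PBond P k, q c ^ 2 ≤ ∑ c : PBond P k, A ^ 2 * (B * s + D) ^ 2 * ρ c ^ 2 := Finset.sum_le_sum fun c _ => hper c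
    _ = A ^ 2 * (B * s + D) ^ 2 * ∑ c : PBond P k, ρ c ^ 2 := by rw [Finset.mul_sum]
    _ ≤ A ^ 2 * (B * s + D) ^ 2 * ∑ c : PBond P k, (Creg * V⁻¹ * ∑ b : PBond P 0,
          (if ((iterBlockOf k b.src = c.src ∨ iterBlockOf k b.src = c.tgt) ∧ (iterBlockOf k b.tgt = c.src ∨ iterBlockOf k b.tgt = c.tgt)) then f b else 0)) :=
        mul_le_mul_of_nonneg_left (Finset.sum_le_sum fun c _ => hreg c) hK0
    _ = A ^ 2 * (B * s + D) ^ 2 * (Creg * V⁻¹) * ∑ c : PBond P k, ∑ b : PBond P 0,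
          (if ((iterBlockOf k b.src = c.src ∨ iterBlockOf k b.src = c.tgt) ∧ (iterBlockOf k b.tgt = c.src ∨ iterBlockOf k b.tgt = c.tgt)) then f b else 0) := by
        rw [← Finset.mul_sum]; ring
    _ ≤ A ^ 2 * (B * s + D) ^ 2 * (Creg * V⁻¹) * (2 * P.d * ∑ b : PBond P 0, f b) :=
        mul_le_mul_of_nonneg_left (sum_sum_twoBlock_le f hf) (by positivity)

end Ell2

/-! ## §4 ★★ The flat-datum `Q^{(k)}`-defect in `ℓ²`, k-UNIFORM under the interior mean-value input -/

/-- ★★ **BRICK (b) AT THE FLAT DATUM, IN `ℓ²`, WITH THE LOCAL SUPS AND THE INTERIOR MEAN-VALUE INPUT DISPLAYED.**  `k ≤ m + K`; `W` a finest `SU(n)` field in the (0.4)-fibre of the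
trivial datum (`avg^k W = 1`); local radii `0 ≤ ρ_c ≤ s` with `‖W_b − 1‖ ≤ ρ_c` on the bonds inside the two `k`-blocks of `c`; the smallness rows at the global radius `s`
(`200ℓ′m(s) ≤ 1`, `C₂m(s) ≤ 1`, `4ℓ′m(s) < δ_N`, `m(x) = (d+1)L^k x`); the displayed mean-value input `ρ_c² ≤ C_reg·(L^k)^{−3}·Σ_{b ⊂ B^k(c₋)∪B^k(c₊)}‖W_b − 1‖²`.  THEN
`Σ_c ‖Q^{(k)}(W − 1)(c)‖² ≤ (C₂·(d+1)L^k)²·((d+1)L^k·s + 0)²·C_reg(L^k)^{−3}·2d·Σ_b‖W_b − 1‖²` `= [2d·C₂²(d+1)⁴C_reg]·(L^k s)²·L^k·Σ_b‖W_b − 1‖²`: with `s = ε₂L^{−k}` the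
constraint-defect energy is `O(ε₂²)·L^k·Σ‖Y‖²`, i.e. `O(ε₂²)·L^{−2k}Σ‖Y‖²` in S2′'s bookkeeping (`E₂ = L^{3k}q`, weight `32L^{−7k}`) and `O(ε₂²)·Σ‖Y‖²` in N8's (`28L^k·Σ_c‖Q^{(k)}Y‖²`) —
k-UNIFORM, as LOCATED; with the GLOBAL sup in place of `ρ_c` it would be off by `L^{3k}`. [cite: Balaban1985Averaging, Prop. 4 (134)–(135) p.38, Prop. 5 (156)–(157) p.42; Balaban1987RG1, (0.4)+(0.11) p.253] -/
theorem sum_normSq_linAvgIterM_sub_one_le_of_localReg {k : ℕ} (hk : k ≤ P.m + P.K)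
    (W : GaugeField P 0 (Matrix.specialUnitaryGroup n ℂ))
    (hfib : ∀ c : PBond P k, Averaging.iter (fun i => blockAvg (P := P) (j := i) (expMeanLogSU (n := n))) k W c = 1)
    {s Creg : ℝ} (hCreg : 0 ≤ Creg) (ρ : PBond P k → ℝ) (hρ0 : ∀ c, 0 ≤ ρ c) (hρs : ∀ c, ρ c ≤ s)
    (hρ : ∀ (c : PBond P k) (b : PBond P 0), (iterBlockOf k b.src = c.src ∨ iterBlockOf k b.src = c.tgt) → (iterBlockOf k b.tgt = c.src ∨ iterBlockOf k b.tgt = c.tgt) →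
      ‖((W b : Matrix.specialUnitaryGroup n ℂ) : Matrix n n ℂ) - 1‖ ≤ ρ c)
    (hreg : ∀ c : PBond P k, ρ c ^ 2 ≤ Creg * (((P.L : ℝ) ^ k) ^ 3)⁻¹ * ∑ b : PBond P 0,
        (if ((iterBlockOf k b.src = c.src ∨ iterBlockOf k b.src = c.tgt) ∧ (iterBlockOf k b.tgt = c.src ∨ iterBlockOf k b.tgt = c.tgt))
          then ‖((W b : Matrix.specialUnitaryGroup n ℂ) : Matrix n n ℂ) - 1‖ ^ 2 else 0))
    (h200 : 200 * (((P.d + 2) * P.L : ℕ) : ℝ) * (((P.d : ℝ) + 1) * (P.L : ℝ) ^ k * s) ≤ 1)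
    (hm : (((P.d : ℝ) + 1) * ((18 : ℝ) ^ P.d * (2 + ((P.d : ℝ) + 1) * (18 : ℝ) ^ P.d)) * (5200 * (((P.d + 2) * P.L : ℕ) : ℝ) ^ 2) /
        ((P.L : ℝ) * ((P.L : ℝ) - 1))) * (((P.d : ℝ) + 1) * (P.L : ℝ) ^ k * s) ≤ 1)
    (hNδ : 4 * (((P.d + 2) * P.L : ℕ) : ℝ) * (((P.d : ℝ) + 1) * (P.L : ℝ) ^ k * s) < deltaSU n) :
    ∑ c : PBond P k, ‖linAvgIterM k (fun b => ((W b : Matrix.specialUnitaryGroup n ℂ) : Matrix n n ℂ) - 1) c‖ ^ 2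
      ≤ ((((P.d : ℝ) + 1) * ((18 : ℝ) ^ P.d * (2 + ((P.d : ℝ) + 1) * (18 : ℝ) ^ P.d)) * (5200 * (((P.d + 2) * P.L : ℕ) : ℝ) ^ 2) /
            ((P.L : ℝ) * ((P.L : ℝ) - 1))) * (((P.d : ℝ) + 1) * (P.L : ℝ) ^ k)) ^ 2
          * ((((P.d : ℝ) + 1) * (P.L : ℝ) ^ k) * s + 0) ^ 2 * (Creg * (((P.L : ℝ) ^ k) ^ 3)⁻¹)
          * (2 * P.d * ∑ b : PBond P 0, ‖((W b : Matrix.specialUnitaryGroup n ℂ) : Matrix n n ℂ) - 1‖ ^ 2) := by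
  classical
  have hL1 : (1 : ℝ) < P.L := by exact_mod_cast P.hL.2
  have hL0 : (0 : ℝ) < P.L := by linarith
  have hLL : 0 < (P.L : ℝ) * ((P.L : ℝ) - 1) := mul_pos hL0 (by linarith)
  have hC0 : 0 ≤ (((P.d : ℝ) + 1) * ((18 : ℝ) ^ P.d * (2 + ((P.d : ℝ) + 1) * (18 : ℝ) ^ P.d)) * (5200 * (((P.d + 2) * P.L : ℕ) : ℝ) ^ 2) /
      ((P.L : ℝ) * ((P.L : ℝ) - 1))) := div_nonneg (by positivity) hLL.le
  have hm0 : 0 ≤ ((P.d : ℝ) + 1) * (P.L : ℝ) ^ k := by positivity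
  have hcast0 : (0 : ℝ) ≤ (((P.d + 2) * P.L : ℕ) : ℝ) := Nat.cast_nonneg _
  -- per coarse bond: the local-sup quadratic bound of §2 with the stencil = the two blocks exactly
  have hq : ∀ c : PBond P k, ‖linAvgIterM k (fun b => ((W b : Matrix.specialUnitaryGroup n ℂ) : Matrix n n ℂ) - 1) c‖
      ≤ ((((P.d : ℝ) + 1) * ((18 : ℝ) ^ P.d * (2 + ((P.d : ℝ) + 1) * (18 : ℝ) ^ P.d)) * (5200 * (((P.d + 2) * P.L : ℕ) : ℝ) ^ 2) /
            ((P.L : ℝ) * ((P.L : ℝ) - 1))) * (((P.d : ℝ) + 1) * (P.L : ℝ) ^ k)) * ρ c * ((((P.d : ℝ) + 1) * (P.L : ℝ) ^ k) * ρ c + 0) := by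
    intro c
    have hmono : ((P.d : ℝ) + 1) * (P.L : ℝ) ^ k * ρ c ≤ ((P.d : ℝ) + 1) * (P.L : ℝ) ^ k * s := mul_le_mul_of_nonneg_left (hρs c) hm0
    have h := norm_linAvgIterM_sub_one_le_of_iter_eq_one (n := n) hk
      {x : Site P 0 | iterBlockOf k x = c.src ∨ iterBlockOf k x = c.tgt} c (fun x hx => hx) W (hfib c) (hρ0 c)
      (fun b h1 h2 => hρ c b h1 h2)
      ((mul_le_mul_of_nonneg_left hmono (by positivity)).trans h200)
      ((mul_le_mul_of_nonneg_left hmono hC0).trans hm)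
      (lt_of_le_of_lt (mul_le_mul_of_nonneg_left hmono (by positivity)) hNδ)
    calc _ ≤ _ := h
      _ = _ := by ring
  exact sum_sq_le_of_localSup_of_localReg (fun c => ‖linAvgIterM k (fun b => ((W b : Matrix.specialUnitaryGroup n ℂ) : Matrix n n ℂ) - 1) c‖) ρ
    (fun b => ‖((W b : Matrix.specialUnitaryGroup n ℂ) : Matrix n n ℂ) - 1‖ ^ 2) (fun b => sq_nonneg _)
    (mul_nonneg hC0 hm0) hm0 le_rfl hCreg (by positivity : (0 : ℝ) < ((P.L : ℝ) ^ k) ^ 3) hq (fun c => norm_nonneg _) hρ0 hρs hreg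

end Summit.QuantumFields.YangMills.Theorems.Prop7FibreQDefect

end
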